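import Summits.AtomisticToContinuum.HydrodynamicLimit.Theses.LambertianContactSwap
import Literature.Analysis.FluidPDE.HardSphereFlowMeasurable
import Literature.MathematicalPhysics.KineticTheory.HardSphereEulerProofs
import Mathlib.Probability.Distributions.Gaussian.Basic
import Summits.AtomisticToContinuum.HydrodynamicLimit.Theorems.OneFlightGossipEngineKacPairHeatFlux
import HarnessLib

/-!
# Generic helpers of the transfer skeleton of line `Sketch` (crux `ContactAngleEquidistribution`,
# stmt-AtomisticToContinuum-12097; lead c4)

Helper file (`--supports stmt-AtomisticToContinuum-12097`), the tools of the kernel-checked composition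
`contactAngleEquidistribution_of_kernel` (`…TransferKernel.lean`), verbatim from the skeleton
`Cruxes/ContactAngleEquidistribution/Lines/Sketch.lean` (leads 0–c1): the three-way `ite` split of a selected
summand (isolated-capped + near-field-capped + fast) with `Decidable` instances as implicit ARGUMENTS (so that the
lemmas apply whatever instances the route file synthesised), termwise domination of scaled triple sums, the bound
`|ψ(n₀) − ∫ ψ ∘ f dγ| ≤ 2`, and the joint measurability of the marks of the crux functional (positions, velocities,
minimal-image separations, contact midpoints, the near-field event, the Lambertian direction map, the mark
`ψ(s, x_mid, v_i, v_j, ω)` and its `κ_g`-average). All folklore.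
-/

noncomputable section

open MeasureTheory Filter Set Topology ProbabilityTheory
open scoped ENNReal BigOperators Classical RealInnerProductSpace

namespace Summit.AtomisticToContinuum.HydrodynamicLimit.Theorems.ContactAngleEquidistributionSketch

open Literature.Analysis.FluidPDE Literature.MathematicalPhysics.KineticTheory

namespace Transfer

/-! ## Generic helpers for the composition (from the skeleton) (no hard-sphere object appears; `Decidable` instances are
implicit ARGUMENTS, filled by unification, so that the lemmas apply whatever instances the route file and
this file synthesised) -/

/-- Three-way split of a selected summand: isolated-capped + near-capped + fast. [folklore] -/
theorem ite_split3 {p q r : Prop} {ip₀ ip₁ ip₂ ip₃ : Decidable p} {iq₁ iq₂ : Decidable q}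
    {ir₁ ir₂ ir₃ : Decidable r} {s : ℝ} :
    @ite _ p ip₀ s 0 =
      @ite _ p ip₁ (@ite _ q iq₁ 0 (@ite _ r ir₁ 0 s)) 0 +
        @ite _ p ip₂ (@ite _ q iq₂ (@ite _ r ir₂ 0 s) 0) 0 +
          @ite _ p ip₃ (@ite _ r ir₃ s 0) 0 := by
  split_ifs <;> ring

/-- Splitting a scaled triple sum along a termwise three-way split. [folklore] -/
theorem mul_sum3_split {ι : Type*} (K : Finset ι) (n : ℕ) (c : ℝ)
    (f a b r : ι → Fin n → Fin n → ℝ) (h : ∀ m i j, f m i j = a m i j + b m i j + r m i j) :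
    c * ∑ m ∈ K, ∑ i : Fin n, ∑ j : Fin n, f m i j =
      c * ∑ m ∈ K, ∑ i : Fin n, ∑ j : Fin n, a m i j +
        c * ∑ m ∈ K, ∑ i : Fin n, ∑ j : Fin n, b m i j +
          c * ∑ m ∈ K, ∑ i : Fin n, ∑ j : Fin n, r m i j := by
  rw [← mul_add, ← mul_add, ← Finset.sum_add_distrib, ← Finset.sum_add_distrib]
  congr 1
  refine Finset.sum_congr rfl fun m _ => ?_
  rw [← Finset.sum_add_distrib, ← Finset.sum_add_distrib]
  refine Finset.sum_congr rfl fun i _ => ?_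
  rw [← Finset.sum_add_distrib, ← Finset.sum_add_distrib]
  exact Finset.sum_congr rfl fun j _ => h m i j

/-- Nonnegativity of a scaled triple sum of nonnegative terms. [folklore] -/
theorem mul_sum3_nonneg {ι : Type*} (K : Finset ι) (n : ℕ) {c : ℝ} (hc : 0 ≤ c)
    (f : ι → Fin n → Fin n → ℝ) (h : ∀ m i j, 0 ≤ f m i j) :
    0 ≤ c * ∑ m ∈ K, ∑ i : Fin n, ∑ j : Fin n, f m i j :=
  mul_nonneg hc (Finset.sum_nonneg fun m _ => Finset.sum_nonneg fun i _ =>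
    Finset.sum_nonneg fun j _ => h m i j)

/-- Termwise domination of a scaled triple sum. [folklore] -/
theorem abs_mul_sum3_le {ι : Type*} (K : Finset ι) (n : ℕ) {c : ℝ} (hc : 0 ≤ c) (κ : ℝ)
    (f g : ι → Fin n → Fin n → ℝ) (h : ∀ m i j, |f m i j| ≤ κ * g m i j) :
    |c * ∑ m ∈ K, ∑ i : Fin n, ∑ j : Fin n, f m i j| ≤
      κ * (c * ∑ m ∈ K, ∑ i : Fin n, ∑ j : Fin n, g m i j) := by
  rw [abs_mul, abs_of_nonneg hc, mul_left_comm, Finset.mul_sum]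
  refine mul_le_mul_of_nonneg_left ?_ hc
  refine (Finset.abs_sum_le_sum_abs _ _).trans (Finset.sum_le_sum fun m _ => ?_)
  rw [Finset.mul_sum]
  refine (Finset.abs_sum_le_sum_abs _ _).trans (Finset.sum_le_sum fun i _ => ?_)
  rw [Finset.mul_sum]
  exact (Finset.abs_sum_le_sum_abs _ _).trans (Finset.sum_le_sum fun j _ => h m i j)

/-- `|x² d| ≤ 2(1 + x³)` for `x ≥ 0`, `|d| ≤ 2`. [folklore] -/
theorem abs_sq_mul_le {x d : ℝ} (hx : 0 ≤ x) (hd : |d| ≤ 2) : |x ^ 2 * d| ≤ 2 * (1 + x ^ 3) := by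
  rw [abs_mul, abs_pow, abs_of_nonneg hx]
  have h2 := KacPair.sq_le_one_add_cube hx
  calc x ^ 2 * |d| ≤ x ^ 2 * 2 := by gcongr
    _ ≤ 2 * (1 + x ^ 3) := by linarith

/-- The weight term `[hit] (1 + x³)` is nonnegative. [folklore] -/
theorem termW_nonneg {p : Prop} {ip : Decidable p} {x : ℝ} (hx : 0 ≤ x) :
    0 ≤ @ite _ p ip (1 + x ^ 3) 0 := by
  split_ifs <;> positivity

/-- The isolated-capped term is dominated by twice the weight term. [folklore] -/
theorem termA_le_W {p q r : Prop} {ip ip' : Decidable p} {iq : Decidable q} {ir : Decidable r}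
    {x d : ℝ} (hx : 0 ≤ x) (hd : |d| ≤ 2) :
    |@ite _ p ip (@ite _ q iq 0 (@ite _ r ir 0 (x ^ 2 * d))) 0| ≤ 2 * @ite _ p ip' (1 + x ^ 3) 0 := by
  by_cases hp : p
  · simp only [if_pos hp]
    by_cases hq : q
    · simp only [if_pos hq, abs_zero]; positivity
    · simp only [if_neg hq]
      by_cases hr : r
      · simp only [if_pos hr, abs_zero]; positivity
      · simp only [if_neg hr]; exact abs_sq_mul_le hx hd
  · simp only [if_neg hp, abs_zero, mul_zero, le_refl]

/-- The near-capped term is dominated by twice the weight term. [folklore] -/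
theorem termB_le_W {p q r : Prop} {ip ip' : Decidable p} {iq : Decidable q} {ir : Decidable r}
    {x d : ℝ} (hx : 0 ≤ x) (hd : |d| ≤ 2) :
    |@ite _ p ip (@ite _ q iq (@ite _ r ir 0 (x ^ 2 * d)) 0) 0| ≤ 2 * @ite _ p ip' (1 + x ^ 3) 0 := by
  by_cases hp : p
  · simp only [if_pos hp]
    by_cases hq : q
    · simp only [if_pos hq]
      by_cases hr : r
      · simp only [if_pos hr, abs_zero]; positivity
      · simp only [if_neg hr]; exact abs_sq_mul_le hx hd
    · simp only [if_neg hq, abs_zero]; positivity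
  · simp only [if_neg hp, abs_zero, mul_zero, le_refl]

/-- The fast term is dominated by `2/V` times the weight term. [folklore] -/
theorem termR_le_W {p r : Prop} {ip ip' : Decidable p} {ir : Decidable r} {x d V : ℝ} (hV : 0 < V)
    (hx : 0 ≤ x) (hd : |d| ≤ 2) (hr : r → V < x) :
    |@ite _ p ip (@ite _ r ir (x ^ 2 * d) 0) 0| ≤ 2 / V * @ite _ p ip' (1 + x ^ 3) 0 := by
  by_cases hp : p
  · simp only [if_pos hp]
    by_cases hr' : r
    · simp only [if_pos hr']
      have hVx := hr hr'
      rw [abs_mul, abs_pow, abs_of_nonneg hx]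
      calc x ^ 2 * |d| ≤ x ^ 2 * 2 := by gcongr
        _ ≤ 2 / V * (1 + x ^ 3) := by
            rw [div_mul_eq_mul_div, le_div_iff₀ hV]
            nlinarith [sq_nonneg x, hVx.le, mul_nonneg (sq_nonneg x) (sub_nonneg.2 hVx.le)]
    · simp only [if_neg hr', abs_zero]; positivity
  · simp only [if_neg hp, abs_zero, mul_zero, le_refl]

/-- `|ψ(n₀) − ∫ ψ(f ξ) γ(dξ)| ≤ 2` for `|ψ| ≤ 1` and a probability measure `γ` (the `κ_g`-centred mark is
bounded by `2`; the Bochner integral of a non-integrable function is `0`, also fine). [folklore] -/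
theorem abs_sub_avg_le_two {β : Type*} [MeasurableSpace β] (γ : Measure β) [IsProbabilityMeasure γ]
    (φ : ℝ → T3 → V3 → V3 → V3 → ℝ) (hφ : ∀ s x v w n, |φ s x v w n| ≤ 1) (s : ℝ) (x : T3)
    (v w n₀ : V3) (f : β → V3) : |φ s x v w n₀ - ∫ ξ, φ s x v w (f ξ) ∂γ| ≤ 2 := by
  have h1 : |∫ ξ, φ s x v w (f ξ) ∂γ| ≤ 1 := by
    have := norm_integral_le_of_norm_le_const (μ := γ) (f := fun ξ => φ s x v w (f ξ)) (C := 1)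
      (Eventually.of_forall fun ξ => by simpa only [Real.norm_eq_abs] using hφ s x v w (f ξ))
    simpa only [Real.norm_eq_abs, probReal_univ, mul_one] using this
  calc |φ s x v w n₀ - ∫ ξ, φ s x v w (f ξ) ∂γ| ≤ |φ s x v w n₀| + |∫ ξ, φ s x v w (f ξ) ∂γ| :=
        abs_sub _ _
    _ ≤ 1 + 1 := add_le_add (hφ s x v w n₀) h1
    _ = 2 := by norm_num

/-! ## Measurability of the marks (torus geometry, `N + 1` spheres) -/

section MarkMeasurability

variable {N : ℕ}

/-- Position of sphere `i`, read on `ℝ × Config`. [folklore] -/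
theorem measurable_pos₂ (i : Fin (N + 1)) :
    Measurable fun p : ℝ × Config (N + 1) (Fin 3) T3 => (p.2 i).1 :=
  measurable_fst.comp ((measurable_pi_apply i).comp measurable_snd)

/-- Velocity of sphere `i`, read on `ℝ × Config`. [folklore] -/
theorem measurable_vel₂ (i : Fin (N + 1)) :
    Measurable fun p : ℝ × Config (N + 1) (Fin 3) T3 => (p.2 i).2 :=
  measurable_snd.comp ((measurable_pi_apply i).comp measurable_snd)

/-- Minimal-image separation of a pair, read on `ℝ × Config`. [folklore] -/
theorem measurable_sepVec₂ (i j : Fin (N + 1)) :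
    Measurable fun p : ℝ × Config (N + 1) (Fin 3) T3 =>
      (Torus.geometry (Fin 3)).sepVec (p.2 i).1 (p.2 j).1 :=
  Torus.isMeasurable_geometry.measurable_sepVec.comp ((measurable_pos₂ i).prodMk (measurable_pos₂ j))

/-- The contact midpoint `x_j + ½ sepVec(x_i, x_j)`, read on `ℝ × Config`, is measurable. [folklore] -/
theorem measurable_xmid₂ (i j : Fin (N + 1)) :
    Measurable fun p : ℝ × Config (N + 1) (Fin 3) T3 =>
      (Torus.geometry (Fin 3)).translate (p.2 j).1
        ((2 : ℝ)⁻¹ • (Torus.geometry (Fin 3)).sepVec (p.2 i).1 (p.2 j).1) :=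
  Torus.isMeasurable_geometry.measurable_translate.comp
    ((measurable_pos₂ j).prodMk ((continuous_const_smul _).measurable.comp (measurable_sepVec₂ i j)))

/-- The v4 near-field event "a third centre within `3e` of the contact midpoint of `(i, j)`" is measurable.
[folklore] -/
theorem measurableSet_nearBall (e : ℝ) (i j : Fin (N + 1)) :
    MeasurableSet {p : ℝ × Config (N + 1) (Fin 3) T3 | ∃ k : Fin (N + 1), k ≠ i ∧ k ≠ j ∧
      ‖(Torus.geometry (Fin 3)).sepVec (p.2 k).1
          ((Torus.geometry (Fin 3)).translate (p.2 j).1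
            ((2 : ℝ)⁻¹ • (Torus.geometry (Fin 3)).sepVec (p.2 i).1 (p.2 j).1))‖ ≤ 3 * e} := by
  refine measurableSet_setOf.2 (Measurable.exists fun k => measurable_const.and
    (measurable_const.and ?_))
  have h : Measurable fun p : ℝ × Config (N + 1) (Fin 3) T3 =>
      (Torus.geometry (Fin 3)).sepVec (p.2 k).1
        ((Torus.geometry (Fin 3)).translate (p.2 j).1
          ((2 : ℝ)⁻¹ • (Torus.geometry (Fin 3)).sepVec (p.2 i).1 (p.2 j).1)) :=
    Torus.isMeasurable_geometry.measurable_sepVec.comp ((measurable_pos₂ k).prodMk (measurable_xmid₂ i j))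
  exact measurableSet_setOf.1 (measurableSet_le h.norm measurable_const)

/-- The Lambertian direction map `(ω, ξ) ↦ normalize(ω̂ + ξ̂)` is measurable. [folklore] -/
theorem measurable_ldir₂ :
    Measurable fun q : V3 × V3 =>
      ‖‖q.1‖⁻¹ • q.1 + ‖q.2‖⁻¹ • q.2‖⁻¹ • (‖q.1‖⁻¹ • q.1 + ‖q.2‖⁻¹ • q.2) := by
  have ha : Measurable fun q : V3 × V3 => ‖q.1‖⁻¹ • q.1 + ‖q.2‖⁻¹ • q.2 :=
    (measurable_fst.norm.inv.smul measurable_fst).add (measurable_snd.norm.inv.smul measurable_snd)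
  exact ha.norm.inv.smul ha

variable {φ : ℝ → T3 → V3 → V3 → V3 → ℝ}

/-- The mark `ψ(s, x_mid, vᵢ, vⱼ, ε⁻¹(xᵢ − xⱼ))` is jointly measurable in `(s, y)`. [folklore] -/
theorem measurable_markPsi
    (hφ : Measurable fun p : ℝ × T3 × V3 × V3 × V3 => φ p.1 p.2.1 p.2.2.1 p.2.2.2.1 p.2.2.2.2)
    (e : ℝ) (i j : Fin (N + 1)) :
    Measurable fun p : ℝ × Config (N + 1) (Fin 3) T3 =>
      φ p.1 ((Torus.geometry (Fin 3)).translate (p.2 j).1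
          ((2 : ℝ)⁻¹ • (Torus.geometry (Fin 3)).sepVec (p.2 i).1 (p.2 j).1))
        (p.2 i).2 (p.2 j).2 (e⁻¹ • (Torus.geometry (Fin 3)).sepVec (p.2 i).1 (p.2 j).1) := by
  have h2 : Measurable fun v : V3 => (2 : ℝ)⁻¹ • v := (continuous_const_smul _).measurable
  have he : Measurable fun v : V3 => e⁻¹ • v := (continuous_const_smul _).measurable
  have hx : Measurable fun p : ℝ × Config (N + 1) (Fin 3) T3 =>
      (Torus.geometry (Fin 3)).translate (p.2 j).1
        ((2 : ℝ)⁻¹ • (Torus.geometry (Fin 3)).sepVec (p.2 i).1 (p.2 j).1) :=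
    Torus.isMeasurable_geometry.measurable_translate.comp
      ((measurable_pos₂ j).prodMk (h2.comp (measurable_sepVec₂ i j)))
  exact hφ.comp (measurable_fst.prodMk (hx.prodMk ((measurable_vel₂ i).prodMk
    ((measurable_vel₂ j).prodMk (he.comp (measurable_sepVec₂ i j))))))

/-- The `κ_g`-average `∫ ψ(s, x_mid, vᵢ, vⱼ, normalize(−ĝ + ξ̂)) γ(dξ)` is jointly measurable in
`(s, y)` (a parametrised Bochner integral of a jointly measurable integrand). [folklore] -/
theorem measurable_markAvg
    (hφ : Measurable fun p : ℝ × T3 × V3 × V3 × V3 => φ p.1 p.2.1 p.2.2.1 p.2.2.2.1 p.2.2.2.2)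
    (i j : Fin (N + 1)) :
    Measurable fun p : ℝ × Config (N + 1) (Fin 3) T3 =>
      ∫ ξ, φ p.1 ((Torus.geometry (Fin 3)).translate (p.2 j).1
          ((2 : ℝ)⁻¹ • (Torus.geometry (Fin 3)).sepVec (p.2 i).1 (p.2 j).1))
        (p.2 i).2 (p.2 j).2
        (‖‖-((p.2 i).2 - (p.2 j).2)‖⁻¹ • (-((p.2 i).2 - (p.2 j).2)) + ‖ξ‖⁻¹ • ξ‖⁻¹ •
          (‖-((p.2 i).2 - (p.2 j).2)‖⁻¹ • (-((p.2 i).2 - (p.2 j).2)) + ‖ξ‖⁻¹ • ξ))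
        ∂(stdGaussian V3) := by
  have h2 : Measurable fun v : V3 => (2 : ℝ)⁻¹ • v := (continuous_const_smul _).measurable
  have hx : Measurable fun q : (ℝ × Config (N + 1) (Fin 3) T3) × V3 =>
      (Torus.geometry (Fin 3)).translate (q.1.2 j).1
        ((2 : ℝ)⁻¹ • (Torus.geometry (Fin 3)).sepVec (q.1.2 i).1 (q.1.2 j).1) :=
    (Torus.isMeasurable_geometry.measurable_translate.comp
      ((measurable_pos₂ j).prodMk (h2.comp (measurable_sepVec₂ i j)))).comp
      measurable_fst
  have hg : Measurable fun q : (ℝ × Config (N + 1) (Fin 3) T3) × V3 =>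
      -((q.1.2 i).2 - (q.1.2 j).2) :=
    (((measurable_vel₂ i).comp measurable_fst).sub ((measurable_vel₂ j).comp measurable_fst)).neg
  have hL : Measurable fun q : (ℝ × Config (N + 1) (Fin 3) T3) × V3 =>
      ‖‖-((q.1.2 i).2 - (q.1.2 j).2)‖⁻¹ • (-((q.1.2 i).2 - (q.1.2 j).2)) + ‖q.2‖⁻¹ • q.2‖⁻¹ •
        (‖-((q.1.2 i).2 - (q.1.2 j).2)‖⁻¹ • (-((q.1.2 i).2 - (q.1.2 j).2)) + ‖q.2‖⁻¹ • q.2) := by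
    -- elaborated WITHOUT expected type, then matched: the direct form sends the unifier astray
    have h := measurable_ldir₂.comp (hg.prodMk measurable_snd)
    exact h
  have hF : Measurable (Function.uncurry fun (p : ℝ × Config (N + 1) (Fin 3) T3) (ξ : V3) =>
      φ p.1 ((Torus.geometry (Fin 3)).translate (p.2 j).1
          ((2 : ℝ)⁻¹ • (Torus.geometry (Fin 3)).sepVec (p.2 i).1 (p.2 j).1))
        (p.2 i).2 (p.2 j).2
        (‖‖-((p.2 i).2 - (p.2 j).2)‖⁻¹ • (-((p.2 i).2 - (p.2 j).2)) + ‖ξ‖⁻¹ • ξ‖⁻¹ •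
          (‖-((p.2 i).2 - (p.2 j).2)‖⁻¹ • (-((p.2 i).2 - (p.2 j).2)) + ‖ξ‖⁻¹ • ξ))) :=
    hφ.comp ((measurable_fst.comp measurable_fst).prodMk (hx.prodMk
      (((measurable_vel₂ i).comp measurable_fst).prodMk
        (((measurable_vel₂ j).comp measurable_fst).prodMk hL))))
  exact (hF.stronglyMeasurable.integral_prod_right (ν := stdGaussian V3)).measurable

end MarkMeasurability

end Transfer

end Summit.AtomisticToContinuum.HydrodynamicLimit.Theorems.ContactAngleEquidistributionSketch

end
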